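import Literature.NumberTheory.EllipticCurves.LangHeightBernoulliPositivityProofs
import Mathlib.Algebra.Order.Chebyshev
import HarnessLib

/-!
# Petsche's Lemma 3: the counting argument (local decomposition `λ_v = i_v + j_v` ⇒ the bound)

Pure proofs (theorems only) in topic `NumberTheory/EllipticCurves` (family `abc`, G06), for the
named fact `Literature.NumberTheory.EllipticCurves.Petsche2006_lemma3` (file
`LangHeightNonarchEstimate.lean`; C. Petsche, *Small rational points on elliptic curves over number
fields*, New York J. Math. 12 (2006), Lemma 3), the last remaining input of the formal proof of
Petsche's Theorem 2 over `ℚ` (`Petsche2006_langHeightLowerBound_of_lemma3`,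
`LangHeightKodairaNeronProofs.lean`).

Petsche's proof of Lemma 3 (journal pp. 260–261; arXiv math/0508160, pp. 3–4) has a local-analytic
half — the decomposition `λ_v(P − Q) = i_v(P, Q) + j_v(P, Q)` of the Néron local height at a finite
place with `i_v ≥ 0`, `i_v(P, Q) ≥ (1/12)(log|1/Δ_v|_v − log⁺|j_E|_v)` when `P − Q ∈ E₀(k_v)`,
`j_v = ½ B₂(r(P − Q)) log⁺|j_E|_v` for a homomorphism `r` into `ℝ/ℤ` with finite cyclic image,
`j_v = 0` if `|j_E|_v ≤ 1` (Tate's uniformisation, ATAEC VI.4.1–VI.4.2) — and a purely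
**combinatorial half**, displays (15)–(18):

* `M = #{(i, j) : P_i − P_j ∈ E₀(k_v)} = Σ_C N_C² ≥ N²/c_v` over the `c_v` cosets `C` of
  `E₀(k_v)` (display (16), Cauchy–Schwarz);
* `Σ_{i ≠ j} j_v(P_i, P_j) ≥ (N²/c² − N)(1/12) log⁺|j_E|_v` when `r` takes values in `(1/c)ℤ/ℤ`
  (display (18), positivity of the Fourier coefficients of `B₂`; proved on `ZMod c` in
  `LangHeightBernoulliPositivityProofs.lean`);
* and their combination with `log⁺|j_E|_v ≤ log|1/Δ_v|_v` into
  `Λ_v(Z) ≥ (1/c_v² − 1/N)(1/12) log|1/Δ_v|_v`.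

This file proves the combinatorial half once and for all, abstractly (`Petsche2006.lemma3_counting`):
for `N ≥ 1` points indexed by a finite set `Z`, real numbers `L ≥ J ≥ 0` (standing for
`log|1/Δ_v|_v` and `log⁺|j_E|_v`), a coset label `f` with at most `c` values (the class modulo
`E₀(k_v)`, `c = c_v`), a label `r` with values in `ZMod c'`, `1 ≤ c' ≤ c` (Petsche's `r`, whose
image has order dividing `c_v`), and any pair function `Λ` with
`Λ(i, j) ≥ [f i = f j] (L − J)/12 + ½ B₂((r_i − r_j).val/c') J` for `i ≠ j`, one has
`(1/c² − 1/N) L/12 ≤ N⁻² Σ_{i ≠ j} Λ(i, j)` — literally the shape of `Petsche2006_lemma3` with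
`Λ(i, j) = λ_v(P_i − P_j)`. The two labels are kept distinct because at a place of additive,
potentially multiplicative reduction the image of `r` (order `c' ≤ 2`) is smaller than
`E(k_v)/E₀(k_v)` (order `c_v ≤ 4`); at a split multiplicative place `f = r`, `c = c' = ord_v(Δ)`,
`L = J`; at a place of potentially good reduction `J = 0`, `c' = 1`.

What then remains of Lemma 3 is exactly its local-analytic half for Tate's `λ_v` on `E(ℚ) ⊂ E(ℚ_v)`,
reduction type by reduction type (split multiplicative: the explicit formula by level on the Tate
normal form and the component homomorphism `TateNormalFormComponents.lean`; non-split and additive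
potentially multiplicative: the same over a quadratic extension; potentially good: `λ_v ≥ 0`).

## References

* C. Petsche, *Small rational points on elliptic curves over number fields*, New York J. Math. 12
  (2006), 257–268 (arXiv math/0508160): Lemma 3 and its proof, displays (13)–(18).
* M. Hindry, J. H. Silverman, *On Lehmer's conjecture for elliptic curves*, Sém. Théorie des
  Nombres Paris 1988–89, Progr. Math. 91 (1990), 103–116, Prop. 1.2.

## Design

Theorems only; namespace `Literature.NumberTheory.EllipticCurves.Petsche2006` (the paper's grouping
namespace of `LangHeightSzpiroRatio.lean`). `B₂` is written out as `t² − t + 1/6` as in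
`LangHeightBernoulliPositivityProofs.lean`.
-/

noncomputable section

open Finset

namespace Literature.NumberTheory.EllipticCurves

namespace Petsche2006

/-! ### Display (16): `M = Σ_C N_C² ≥ N²/c` -/

/-- **Petsche 2006, proof of Lemma 3, display (16)** in abstract form: if the points of `Z` fall into
the classes of a label `f`, then `Σ_{i ∈ Z} #{j ∈ Z : f j = f i} = Σ_C N_C²` and, by Cauchy–Schwarz
over the classes, `|Z|² ≤ #(classes) · Σ_{i ∈ Z} #{j ∈ Z : f j = f i}`.
[cite: Petsche2006, proof of Lemma 3, (16)] -/
theorem card_sq_le_card_image_mul_sum_card_fiber {ι α : Type*} [DecidableEq α] (Z : Finset ι)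
    (f : ι → α) :
    (Z.card : ℝ) ^ 2 ≤ (Z.image f).card * ∑ i ∈ Z, ((Z.filter fun j => f j = f i).card : ℝ) := by
  set T := Z.image f with hT
  have hmaps : ∀ i ∈ Z, f i ∈ T := fun i hi => mem_image_of_mem f hi
  -- `|Z| = Σ_{a ∈ T} N_a` and `Σ_i N_{f i} = Σ_{a ∈ T} N_a²`
  have hcard : (Z.card : ℝ) = ∑ a ∈ T, ((Z.filter fun j => f j = a).card : ℝ) := by
    rw [card_eq_sum_card_image f Z]
    push_cast
    rfl
  have hsum : ∑ i ∈ Z, ((Z.filter fun j => f j = f i).card : ℝ) =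
      ∑ a ∈ T, ((Z.filter fun j => f j = a).card : ℝ) ^ 2 := by
    rw [← sum_fiberwise_of_maps_to' hmaps (fun a => ((Z.filter fun j => f j = a).card : ℝ))]
    refine sum_congr rfl fun a _ => ?_
    rw [sum_const, nsmul_eq_mul, sq]
  rw [hcard, hsum]
  exact sq_sum_le_card_mul_sum_sq

/-! ### The counting argument -/

/-- **Petsche 2006, Lemma 3 — the counting argument** (proof of Lemma 3, displays (15)–(18) and
the final combination, journal pp. 260–261). Let `Z` index `N ≥ 1` distinct points, let
`L ≥ J ≥ 0` (`L = log|1/Δ_v|_v`, `J = log⁺|j_E|_v`, `J ≤ L` by AEC VII.5.1), let `f` label the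
cosets of `E₀(k_v)` met by the points (at most `c = c_v` of them) and `r` be Petsche's map into
`(1/c')ℤ/ℤ ≅ ZMod c'` with `c' ≤ c`, and suppose the local decomposition bound
`Λ(i, j) ≥ [f i = f j] · (L − J)/12 + ½ B₂((r_i − r_j).val/c') · J` for all `i ≠ j`
(`λ_v = i_v + j_v` with `i_v ≥ 0`, display (15) on `E₀`-differences, and the `B₂`-formula for
`j_v`). Then `(1/c² − 1/N) · L/12 ≤ N⁻² Σ_{i} Σ_{j ≠ i} Λ(i, j)`. Proof: `M − N ≥ N²/c − N` same-class
ordered pairs (`card_sq_le_card_image_mul_sum_card_fiber`, display (16)), the `B₂`-positivity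
`Σ_{i ≠ j} B₂ ≥ N²/(6c'²) − N/6` (`card_sq_div_sub_le_sum_sum_erase_bernoulli`, display (18)), and
`(L − J)/c + J/c'² ≥ L/c²`. [cite: Petsche2006, Lemma 3] -/
theorem lemma3_counting {ι α : Type*} [DecidableEq ι] [DecidableEq α] (Z : Finset ι)
    (hZ : Z.Nonempty) {c c' : ℕ} (hc : 0 < c) (hc' : 0 < c') (hcc : c' ≤ c) {L J : ℝ}
    (hJ : 0 ≤ J) (hJL : J ≤ L) (f : ι → α) (hf : (Z.image f).card ≤ c) (r : ι → ZMod c')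
    (Λ : ι → ι → ℝ)
    (hΛ : ∀ i ∈ Z, ∀ j ∈ Z, j ≠ i →
      (if f j = f i then (L - J) / 12 else 0) +
          1 / 2 * ((((r i - r j).val : ℝ) / c') ^ 2 - ((r i - r j).val : ℝ) / c' + 1 / 6) * J ≤
        Λ i j) :
    (1 / (c : ℝ) ^ 2 - 1 / (Z.card : ℝ)) * (1 / 12 * L) ≤
      1 / (Z.card : ℝ) ^ 2 * ∑ i ∈ Z, ∑ j ∈ Z.erase i, Λ i j := by
  set N : ℝ := (Z.card : ℝ) with hN
  have hNpos : 0 < N := by rw [hN]; exact_mod_cast hZ.card_pos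
  have hcR : (0 : ℝ) < c := by exact_mod_cast hc
  have hc'R : (0 : ℝ) < c' := by exact_mod_cast hc'
  have hLJ : 0 ≤ L - J := sub_nonneg.mpr hJL
  -- the same-class count `M' = Σ_i N_{f i} ≥ N²/c`
  set M' : ℝ := ∑ i ∈ Z, ((Z.filter fun j => f j = f i).card : ℝ) with hM'
  have hM' : N ^ 2 / c ≤ M' := by
    rw [div_le_iff₀ hcR]
    have h := card_sq_le_card_image_mul_sum_card_fiber Z f
    have himg : ((Z.image f).card : ℝ) ≤ c := by exact_mod_cast hf
    have hM'0 : 0 ≤ M' := sum_nonneg fun i _ => Nat.cast_nonneg _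
    calc N ^ 2 ≤ (Z.image f).card * M' := h
      _ ≤ c * M' := mul_le_mul_of_nonneg_right himg hM'0
      _ = M' * c := mul_comm _ _
  -- the indicator sum over `j ≠ i` is `M' − N`
  have hind : ∑ i ∈ Z, ∑ j ∈ Z.erase i, (if f j = f i then (L - J) / 12 else (0 : ℝ)) =
      (M' - N) * ((L - J) / 12) := by
    have hrow : ∀ i ∈ Z, ∑ j ∈ Z.erase i, (if f j = f i then (L - J) / 12 else (0 : ℝ)) =
        (((Z.filter fun j => f j = f i).card : ℝ) - 1) * ((L - J) / 12) := by
      intro i hi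
      have hmem : i ∈ Z.filter (fun j => f j = f i) := mem_filter.mpr ⟨hi, rfl⟩
      rw [sum_ite, sum_const_zero, add_zero, sum_const, nsmul_eq_mul, filter_erase,
        card_erase_of_mem hmem, Nat.cast_sub (card_pos.mpr ⟨i, hmem⟩), Nat.cast_one]
    rw [sum_congr rfl hrow, ← sum_mul, sum_sub_distrib, sum_const, nsmul_eq_mul, mul_one]
  -- the Bernoulli sum over `j ≠ i`
  have hbern := card_sq_div_sub_le_sum_sum_erase_bernoulli hc' Z r
  -- sum the hypothesis over all ordered pairs `j ≠ i`
  have hsum : ∑ i ∈ Z, ∑ j ∈ Z.erase i, ((if f j = f i then (L - J) / 12 else (0 : ℝ)) +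
      1 / 2 * ((((r i - r j).val : ℝ) / c') ^ 2 - ((r i - r j).val : ℝ) / c' + 1 / 6) * J) ≤
      ∑ i ∈ Z, ∑ j ∈ Z.erase i, Λ i j :=
    sum_le_sum fun i hi => sum_le_sum fun j hj =>
      hΛ i hi j (mem_of_mem_erase hj) (ne_of_mem_erase hj)
  have hsplit : ∑ i ∈ Z, ∑ j ∈ Z.erase i, ((if f j = f i then (L - J) / 12 else (0 : ℝ)) +
      1 / 2 * ((((r i - r j).val : ℝ) / c') ^ 2 - ((r i - r j).val : ℝ) / c' + 1 / 6) * J) =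
      (M' - N) * ((L - J) / 12) + 1 / 2 * J * ∑ i ∈ Z, ∑ j ∈ Z.erase i,
        ((((r i - r j).val : ℝ) / c') ^ 2 - ((r i - r j).val : ℝ) / c' + 1 / 6) := by
    have hrow : ∀ i, ∑ j ∈ Z.erase i, ((if f j = f i then (L - J) / 12 else (0 : ℝ)) +
        1 / 2 * ((((r i - r j).val : ℝ) / c') ^ 2 - ((r i - r j).val : ℝ) / c' + 1 / 6) * J) =
        ∑ j ∈ Z.erase i, (if f j = f i then (L - J) / 12 else (0 : ℝ)) +
          1 / 2 * J * ∑ j ∈ Z.erase i,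
            ((((r i - r j).val : ℝ) / c') ^ 2 - ((r i - r j).val : ℝ) / c' + 1 / 6) := by
      intro i
      rw [sum_add_distrib, mul_sum]
      congr 1
      exact sum_congr rfl fun j _ => by ring
    rw [sum_congr rfl fun i _ => hrow i, sum_add_distrib, hind, ← mul_sum]
  rw [hsplit] at hsum
  have hbern' : N ^ 2 / (c' : ℝ) ^ 2 / 6 - N / 6 ≤ ∑ i ∈ Z, ∑ j ∈ Z.erase i,
      ((((r i - r j).val : ℝ) / c') ^ 2 - ((r i - r j).val : ℝ) / c' + 1 / 6) := by
    have e : (Z.card : ℝ) ^ 2 / (6 * (c' : ℝ) ^ 2) = (Z.card : ℝ) ^ 2 / (c' : ℝ) ^ 2 / 6 := by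
      ring
    rw [e] at hbern
    exact hbern
  -- lower bound for the total
  have htot : (N ^ 2 / c - N) * ((L - J) / 12) + 1 / 2 * J * (N ^ 2 / (c' : ℝ) ^ 2 / 6 - N / 6) ≤
      ∑ i ∈ Z, ∑ j ∈ Z.erase i, Λ i j := by
    have h1 : (N ^ 2 / c - N) * ((L - J) / 12) ≤ (M' - N) * ((L - J) / 12) :=
      mul_le_mul_of_nonneg_right (sub_le_sub_right hM' N) (by positivity)
    have h2 : 1 / 2 * J * (N ^ 2 / (c' : ℝ) ^ 2 / 6 - N / 6) ≤ 1 / 2 * J * ∑ i ∈ Z,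
        ∑ j ∈ Z.erase i, ((((r i - r j).val : ℝ) / c') ^ 2 - ((r i - r j).val : ℝ) / c' + 1 / 6) :=
      mul_le_mul_of_nonneg_left hbern' (by positivity)
    linarith
  -- `(L − J)/c + J/c'² ≥ L/c²`
  have hkey : N ^ 2 / (c : ℝ) ^ 2 * L ≤ N ^ 2 / c * (L - J) + J * (N ^ 2 / (c' : ℝ) ^ 2) := by
    have hc1 : (1 : ℝ) ≤ c := by exact_mod_cast hc
    have hcc' : (c' : ℝ) ≤ c := by exact_mod_cast hcc
    have e1 : N ^ 2 / (c : ℝ) ^ 2 * (L - J) ≤ N ^ 2 / c * (L - J) := by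
      apply mul_le_mul_of_nonneg_right _ hLJ
      apply div_le_div_of_nonneg_left (by positivity) hcR
      nlinarith
    have e2 : N ^ 2 / (c : ℝ) ^ 2 * J ≤ J * (N ^ 2 / (c' : ℝ) ^ 2) := by
      rw [mul_comm]
      apply mul_le_mul_of_nonneg_left _ hJ
      apply div_le_div_of_nonneg_left (by positivity) (by positivity)
      exact pow_le_pow_left₀ hc'R.le hcc' 2
    nlinarith
  -- conclude, dividing by `N²`
  rw [show (1 / (c : ℝ) ^ 2 - 1 / N) * (1 / 12 * L) =
      1 / N ^ 2 * ((N ^ 2 / (c : ℝ) ^ 2 - N) * (L / 12)) by field_simp]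
  refine mul_le_mul_of_nonneg_left ?_ (by positivity)
  linarith [htot, hkey]

end Petsche2006

end Literature.NumberTheory.EllipticCurves

end
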